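import Literature.NumberTheory.Automorphic.BlockUnipotentDomains
import Literature.NumberTheory.Automorphic.ConstantTermBlockGLParabolic
import Literature.NumberTheory.Automorphic.AdelicSecondCountable
import Literature.NumberTheory.Automorphic.AutomorphicRepsGLCuspBridgeProofs
import Literature.NumberTheory.Automorphic.SupercuspTypeCuspidalImage
import HarnessLib

/-!
# The block unipotent subgroups `N_k(𝔸_K) ≤ GL_n(𝔸_K)`: measure, fundamental domain, averaging data

Topic `NumberTheory/Automorphic`; namespace `Literature.NumberTheory.Automorphic`. The unipotent
radical `N_k = 1 + 𝔫_k` of the standard maximal parabolic `P_k` of `GL_n`, over the adeles, packaged in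
the form required by the averaging step of `Literature.MeasureTheory.Group.CoveringWeightsAveraging`
("integrate first over `N_k(K)\N_k(𝔸_K)`", Godement–Jacquet (1972), §12; Moeglin–Waldspurger
(1995), I.2.6) — everything proved from the tree's `blockNilpotent`/`glUnipotent`
(`GLnCuspidalSpectrum`), Tate's scaled block domains (`BlockUnipotentDomains`) and the parabolic
conjugation `blockNilpotentConj` (`ConstantTermBlockGLParabolic`):

* `blockUnipotentGL n k K ≤ (gl n K).Adelic` and the bijection `toBlockUnipotentGL : 𝔫_k(𝔸_K) → N_k(𝔸_K)`,
  `X ↦ 1 + X` (additive ↦ multiplicative, `toBlockUnipotentGL_add`), with inverse `logBlockUnipotentGL`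
  and the measurable equivalence `blockUnipotentGLMeasurableEquiv`; **`N_k(𝔸_K)` is commutative**
  (`blockUnipotentGL_comm`) and **normalised by `P_k(𝔸_K)`** (`conj_mem_blockUnipotentGL`);
* `blockUnipotentMeasure ν` — the transport of a measure `ν` on `𝔫_k(𝔸_K)`; `lintegral_blockUnipotentMeasure`,
  `setIntegral_blockUnipotentMeasure_image`; **left invariance** `lintegral_blockUnipotentMeasure_mul_left`;
* `map_blockNilpotentConj_eq_self` — **conjugation by a rational element of `P_k` preserves every
  additive Haar measure of `𝔫_k(𝔸_K)`**: the image is again a Haar measure, hence `c ν`; the preimage of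
  Tate's fundamental domain of the lattice `𝔫_k(K)` (preserved by rational conjugation,
  `blockNilpotentConj_mem_rationalBlock`) is again a fundamental domain, of the same measure
  (Mathlib `IsAddFundamentalDomain.measure_eq`), so `c = 1` (Weil, *Basic Number Theory*, I §2:
  the module of a lattice-preserving automorphism is `1`); whence
  `lintegral_blockUnipotentMeasure_conj` and **commutation in the mean**
  `lintegral_blockUnipotentMeasure_mul_comm : ∫ g(p u x) du = ∫ g(u p x) du`;
* `blockUnipotentDomain` — the image of Tate's scaled block domain: Borel, of finite positive measure,
  and a **strict fundamental domain** for `Γ' ∩ N_k(𝔸_K)` whenever `Γ' ∩ N_k(𝔸_K) = N_k(K)`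
  (`existsUnique_mul_mem_blockUnipotentDomain`);
* `setIntegral_blockUnipotentDomain_inv_mul_eq_zero` — **cusp periods vanish**: for `φ` with the
  (left) cusp condition `CuspConditionGL n K φ k` (e.g. `invQuot` of a smoothed cusp form,
  `cuspConditionGL_invQuot_smoothedForm`), `∫_{𝓕_U} φ(u⁻¹ x) du = 0` for all `x`
  (`AutomorphicRepsGL.negTransfer_blockNilpotent`).

## References

* R. Godement, H. Jacquet, *Zeta functions of simple algebras*, LNM 260 (1972), §12
  [GodementJacquetLNM260].
* C. Moeglin, J.-L. Waldspurger, *Spectral decomposition and Eisenstein series* (1995), I.2.6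
  [MoeglinWaldspurger1995].
* A. Weil, *Basic Number Theory* (1967), Ch. I §2 [WeilBNT1967].
* A. Borel, H. Jacquet, Proc. Sympos. Pure Math. 33 (1979), Part 1, 4.4 [BorelJacquet1979].
-/

noncomputable section

open MeasureTheory Measure Set Filter Topology IsDedekindDomain NumberField
open scoped ENNReal NNReal Pointwise

namespace Literature.NumberTheory.Automorphic

/-! ### The subgroup `N_k(𝔸_K)` and its parametrisation by `𝔫_k(𝔸_K)` -/

section Subgroup

variable (n k : ℕ) (K : Type) [Field K] [NumberField K]

/-- **The block unipotent subgroup `N_k(𝔸_K) = 1 + 𝔫_k(𝔸_K) ≤ GL_n(𝔸_K)`** (the unipotent radical of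
the standard maximal parabolic `P_k`), as the range of `glUnipotent`. [folklore] -/
def blockUnipotentGL : Subgroup (AdelicGroupData.gl n K).Adelic :=
  (glUnipotent n k K).range

/-- The parametrisation `X ↦ 1 + X : 𝔫_k(𝔸_K) → N_k(𝔸_K)`. [folklore] -/
def toBlockUnipotentGL (X : blockNilpotent n k (AdeleRing (𝓞 K) K)) : blockUnipotentGL n k K :=
  ⟨glUnipotent n k K (Multiplicative.ofAdd X), ⟨Multiplicative.ofAdd X, rfl⟩⟩

variable {n k K}

/-- An element of the standard maximal parabolic `P_k(𝔸_K)`, viewed in the adelic group of the datum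
`AdelicGroupData.gl n K` (the same unit; this spelling keeps products inside `(gl n K).Adelic`).
[folklore] -/
abbrev parabolicToAdelic (p : standardParabolicGL (AdeleRing (𝓞 K) K) (maximalParabolicLabel n k)) :
    (AdelicGroupData.gl n K).Adelic :=
  ((p : GL (Fin n) (AdeleRing (𝓞 K) K)) : GL (Fin n) (AdeleRing (𝓞 K) K))

/-- The underlying group element of `toBlockUnipotentGL X` is `1 + X`. [folklore] -/
theorem coe_toBlockUnipotentGL (X : blockNilpotent n k (AdeleRing (𝓞 K) K)) :
    ((toBlockUnipotentGL n k K X : blockUnipotentGL n k K) : (AdelicGroupData.gl n K).Adelic) =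
      glUnipotent n k K (Multiplicative.ofAdd X) := rfl

/-- The parametrisation is a bijection. [folklore] -/
theorem toBlockUnipotentGL_bijective : Function.Bijective (toBlockUnipotentGL n k K) := by
  constructor
  · intro X Y h
    have h' := congrArg (fun u : blockUnipotentGL n k K => (u : (AdelicGroupData.gl n K).Adelic)) h
    simp only [coe_toBlockUnipotentGL] at h'
    exact Multiplicative.ofAdd.injective (unipotentOfBlock_injective h')
  · rintro ⟨u, X, rfl⟩
    exact ⟨Multiplicative.toAdd X, rfl⟩

variable (n k K) in
/-- The parametrisation as an equivalence `𝔫_k(𝔸_K) ≃ N_k(𝔸_K)`. [folklore] -/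
def blockUnipotentGLEquiv : blockNilpotent n k (AdeleRing (𝓞 K) K) ≃ blockUnipotentGL n k K :=
  Equiv.ofBijective _ toBlockUnipotentGL_bijective

/-- `blockUnipotentGLEquiv` is `toBlockUnipotentGL`. [folklore] -/
theorem blockUnipotentGLEquiv_apply (X : blockNilpotent n k (AdeleRing (𝓞 K) K)) :
    blockUnipotentGLEquiv n k K X = toBlockUnipotentGL n k K X := rfl

/-- `1 + (X + Y) = (1 + X)(1 + Y)`. [folklore] -/
theorem toBlockUnipotentGL_add (X Y : blockNilpotent n k (AdeleRing (𝓞 K) K)) :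
    toBlockUnipotentGL n k K (X + Y) = toBlockUnipotentGL n k K X * toBlockUnipotentGL n k K Y :=
  Subtype.ext (by rw [Subgroup.coe_mul, coe_toBlockUnipotentGL, coe_toBlockUnipotentGL,
    coe_toBlockUnipotentGL, ofAdd_add, map_mul])

/-- `1 + (-X) = (1 + X)⁻¹`. [folklore] -/
theorem toBlockUnipotentGL_neg (X : blockNilpotent n k (AdeleRing (𝓞 K) K)) :
    toBlockUnipotentGL n k K (-X) = (toBlockUnipotentGL n k K X)⁻¹ :=
  Subtype.ext (by rw [Subgroup.coe_inv, coe_toBlockUnipotentGL, coe_toBlockUnipotentGL, ofAdd_neg, map_inv])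

/-- `toBlockUnipotentGL 0 = 1`. [folklore] -/
theorem toBlockUnipotentGL_zero : toBlockUnipotentGL n k K 0 = 1 :=
  Subtype.ext (by rw [Subgroup.coe_one, coe_toBlockUnipotentGL, ofAdd_zero, map_one])

/-- **`N_k(𝔸_K)` is commutative** (`𝔫_k² = 0`). [folklore] -/
theorem blockUnipotentGL_comm (a b : blockUnipotentGL n k K) : a * b = b * a := by
  obtain ⟨X, rfl⟩ := toBlockUnipotentGL_bijective.2 a
  obtain ⟨Y, rfl⟩ := toBlockUnipotentGL_bijective.2 b
  rw [← toBlockUnipotentGL_add, ← toBlockUnipotentGL_add, add_comm]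

/-- **Conjugation by the parabolic preserves `N_k(𝔸_K)`**: `p (1 + X) p⁻¹ = 1 + p X p⁻¹`. [folklore] -/
theorem toBlockUnipotentGL_blockNilpotentConj
    (p : standardParabolicGL (AdeleRing (𝓞 K) K) (maximalParabolicLabel n k))
    (X : blockNilpotent n k (AdeleRing (𝓞 K) K)) :
    ((toBlockUnipotentGL n k K (blockNilpotentConj p X) : blockUnipotentGL n k K) : (AdelicGroupData.gl n K).Adelic) =
      parabolicToAdelic p * (toBlockUnipotentGL n k K X : (AdelicGroupData.gl n K).Adelic) * (parabolicToAdelic p)⁻¹ :=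
  unipotentOfBlock_blockNilpotentConj p X

/-- Membership of conjugates: `p u p⁻¹ ∈ N_k(𝔸_K)` for `u ∈ N_k(𝔸_K)` and `p ∈ P_k(𝔸_K)`. [folklore] -/
theorem conj_mem_blockUnipotentGL (p : standardParabolicGL (AdeleRing (𝓞 K) K) (maximalParabolicLabel n k))
    {u : (AdelicGroupData.gl n K).Adelic} (hu : u ∈ blockUnipotentGL n k K) :
    parabolicToAdelic p * u * (parabolicToAdelic p)⁻¹ ∈ blockUnipotentGL n k K := by
  obtain ⟨X, rfl⟩ := hu
  refine ⟨Multiplicative.ofAdd (blockNilpotentConj p (Multiplicative.toAdd X)), ?_⟩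
  change ((toBlockUnipotentGL n k K (blockNilpotentConj p (Multiplicative.toAdd X)) : blockUnipotentGL n k K) :
      (AdelicGroupData.gl n K).Adelic) =
    parabolicToAdelic p * (toBlockUnipotentGL n k K (Multiplicative.toAdd X) : (AdelicGroupData.gl n K).Adelic) *
      (parabolicToAdelic p)⁻¹
  exact toBlockUnipotentGL_blockNilpotentConj (K := K) p (Multiplicative.toAdd X)

/-- **Rational parabolic elements preserve the rational lattice `𝔫_k(K)`** under conjugation
(entries of `γ X γ⁻¹` are sums of products of principal adeles). [folklore] -/
theorem blockNilpotentConj_mem_rationalBlock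
    {p : standardParabolicGL (AdeleRing (𝓞 K) K) (maximalParabolicLabel n k)} {γ : GL (Fin n) K}
    (hp : (p : GL (Fin n) (AdeleRing (𝓞 K) K)) = Matrix.GeneralLinearGroup.map (algebraMap K (AdeleRing (𝓞 K) K)) γ)
    {X : blockNilpotent n k (AdeleRing (𝓞 K) K)} (hX : X ∈ rationalBlock n k K) :
    blockNilpotentConj p X ∈ rationalBlock n k K := by
  rw [mem_rationalBlock_iff] at hX ⊢
  intro i j
  rw [coe_blockNilpotentConj, hp]
  have hpinv : (Matrix.GeneralLinearGroup.map (algebraMap K (AdeleRing (𝓞 K) K)) γ)⁻¹ =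
      Matrix.GeneralLinearGroup.map (algebraMap K (AdeleRing (𝓞 K) K)) γ⁻¹ := by
    rw [map_inv]
  rw [hpinv, Matrix.mul_apply]
  refine Subring.sum_mem _ fun c _ => Subring.mul_mem _ ?_ (map_apply_mem_range γ⁻¹ c j)
  rw [Matrix.mul_apply]
  exact Subring.sum_mem _ fun a _ => Subring.mul_mem _ (map_apply_mem_range γ i a) (hX a c)

end Subgroup

/-! ### The parametrisation as a measurable equivalence; the transported Haar measure -/

section MeasureU

variable {n k : ℕ} {K : Type} [Field K] [NumberField K]

attribute [local instance] adelicBorel borelSpace_adelic locallyCompactSpace_adelic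
  secondCountableTopology_gl_adelic

/-- The logarithm `u ↦ u - 1 : N_k(𝔸_K) → 𝔫_k(𝔸_K)`. [folklore] -/
def logBlockUnipotentGL (u : blockUnipotentGL n k K) : blockNilpotent n k (AdeleRing (𝓞 K) K) :=
  ⟨Units.val ((u : blockUnipotentGL n k K) : (AdelicGroupData.gl n K).Adelic) - 1, by
    obtain ⟨u, X, hX⟩ := u
    have h : Units.val (u : (AdelicGroupData.gl n K).Adelic) = 1 + (X.toAdd : Matrix (Fin n) (Fin n) (AdeleRing (𝓞 K) K)) := by
      rw [← hX]; rfl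
    simp only
    rw [h, add_sub_cancel_left]
    exact X.toAdd.2⟩

/-- `log (1 + X) = X`. [folklore] -/
theorem logBlockUnipotentGL_toBlockUnipotentGL (X : blockNilpotent n k (AdeleRing (𝓞 K) K)) :
    logBlockUnipotentGL (toBlockUnipotentGL n k K X) = X := by
  refine Subtype.ext ?_
  change Units.val (glUnipotent n k K (Multiplicative.ofAdd X)) - 1 = (X : Matrix (Fin n) (Fin n) (AdeleRing (𝓞 K) K))
  rw [glUnipotent_apply, coe_unipotentOfBlock, add_sub_cancel_left]
  rfl

/-- `1 + log u = u`. [folklore] -/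
theorem toBlockUnipotentGL_logBlockUnipotentGL (u : blockUnipotentGL n k K) :
    toBlockUnipotentGL n k K (logBlockUnipotentGL u) = u := by
  obtain ⟨X, rfl⟩ := toBlockUnipotentGL_bijective.2 u
  rw [logBlockUnipotentGL_toBlockUnipotentGL]

/-- The parametrisation is continuous. [folklore] -/
theorem continuous_toBlockUnipotentGL : Continuous (toBlockUnipotentGL n k K) :=
  continuous_glUnipotent_ofAdd.subtype_mk _

/-- The logarithm is continuous. [folklore] -/
theorem continuous_logBlockUnipotentGL : Continuous (logBlockUnipotentGL (n := n) (k := k) (K := K)) := by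
  have h : Continuous fun u : blockUnipotentGL n k K =>
      Units.val ((u : blockUnipotentGL n k K) : (AdelicGroupData.gl n K).Adelic) - 1 :=
    (Units.continuous_val.comp continuous_subtype_val).sub continuous_const
  exact h.subtype_mk _

variable (n k K) in
/-- **`X ↦ 1 + X` as a measurable equivalence `𝔫_k(𝔸_K) ≃ᵐ N_k(𝔸_K)`.** [folklore] -/
def blockUnipotentGLMeasurableEquiv : blockNilpotent n k (AdeleRing (𝓞 K) K) ≃ᵐ blockUnipotentGL n k K where
  toFun := toBlockUnipotentGL n k K
  invFun := logBlockUnipotentGL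
  left_inv := logBlockUnipotentGL_toBlockUnipotentGL
  right_inv := toBlockUnipotentGL_logBlockUnipotentGL
  measurable_toFun := continuous_toBlockUnipotentGL.measurable
  measurable_invFun := continuous_logBlockUnipotentGL.measurable

/-- The measurable equivalence is `toBlockUnipotentGL`. [folklore] -/
theorem blockUnipotentGLMeasurableEquiv_apply (X : blockNilpotent n k (AdeleRing (𝓞 K) K)) :
    blockUnipotentGLMeasurableEquiv n k K X = toBlockUnipotentGL n k K X := rfl

variable (n k K) in
/-- **The transported measure** on `N_k(𝔸_K)`: the image of a measure `ν` on `𝔫_k(𝔸_K)` under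
`X ↦ 1 + X` (for `ν` an additive Haar measure this is a Haar measure of `N_k(𝔸_K)`). [folklore] -/
def blockUnipotentMeasure (ν : Measure (blockNilpotent n k (AdeleRing (𝓞 K) K))) : Measure (blockUnipotentGL n k K) :=
  ν.map (toBlockUnipotentGL n k K)

/-- **Integration against the transported measure**: `∫ g du = ∫ g(1 + X) dν(X)`. [folklore] -/
theorem lintegral_blockUnipotentMeasure (ν : Measure (blockNilpotent n k (AdeleRing (𝓞 K) K)))
    (g : blockUnipotentGL n k K → ℝ≥0∞) :
    ∫⁻ u, g u ∂(blockUnipotentMeasure n k K ν) = ∫⁻ X, g (toBlockUnipotentGL n k K X) ∂ν := by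
  change ∫⁻ u, g u ∂(ν.map (blockUnipotentGLMeasurableEquiv n k K)) = _
  rw [lintegral_map_equiv]
  rfl

/-- Bochner version of `lintegral_blockUnipotentMeasure` on a set. [folklore] -/
theorem setIntegral_blockUnipotentMeasure_image (ν : Measure (blockNilpotent n k (AdeleRing (𝓞 K) K)))
    (g : blockUnipotentGL n k K → ℂ) (s : Set (blockNilpotent n k (AdeleRing (𝓞 K) K))) :
    ∫ u in toBlockUnipotentGL n k K '' s, g u ∂(blockUnipotentMeasure n k K ν) =
      ∫ X in s, g (toBlockUnipotentGL n k K X) ∂ν := by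
  set e := blockUnipotentGLMeasurableEquiv n k K with he
  have h := e.measurableEmbedding.setIntegral_map (μ := ν) g (e '' s)
  rw [e.preimage_image] at h
  exact h

/-- The transported measure of an image. [folklore] -/
theorem blockUnipotentMeasure_image (ν : Measure (blockNilpotent n k (AdeleRing (𝓞 K) K)))
    (s : Set (blockNilpotent n k (AdeleRing (𝓞 K) K))) :
    blockUnipotentMeasure n k K ν (toBlockUnipotentGL n k K '' s) = ν s := by
  set e := blockUnipotentGLMeasurableEquiv n k K with he
  change (ν.map e) (e '' s) = ν s
  rw [e.map_apply, e.preimage_image]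

/-- The transported measure of an s-finite measure is s-finite. [folklore] -/
instance sFinite_blockUnipotentMeasure (ν : Measure (blockNilpotent n k (AdeleRing (𝓞 K) K))) [SFinite ν] :
    SFinite (blockUnipotentMeasure n k K ν) := by
  unfold blockUnipotentMeasure; infer_instance

/-- **Left invariance of the transported measure** (in the `lintegral` form of
`CoveringWeightsAveraging`): `∫ g(η u) du = ∫ g(u) du` for every `η ∈ N_k(𝔸_K)`. [folklore] -/
theorem lintegral_blockUnipotentMeasure_mul_left (ν : Measure (blockNilpotent n k (AdeleRing (𝓞 K) K)))
    [ν.IsAddLeftInvariant] (η : blockUnipotentGL n k K) (g : blockUnipotentGL n k K → ℝ≥0∞) :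
    ∫⁻ u, g (η * u) ∂(blockUnipotentMeasure n k K ν) = ∫⁻ u, g u ∂(blockUnipotentMeasure n k K ν) := by
  obtain ⟨Y, rfl⟩ := toBlockUnipotentGL_bijective.2 η
  rw [lintegral_blockUnipotentMeasure, lintegral_blockUnipotentMeasure]
  simp_rw [← toBlockUnipotentGL_add]
  exact lintegral_add_left_eq_self (μ := ν) (fun X => g (toBlockUnipotentGL n k K X)) Y

end MeasureU

/-! ### Conjugation by rational parabolic elements preserves the Haar measure of `𝔫_k(𝔸_K)` -/

section Conj

variable {n k : ℕ} {K : Type} [Field K] [NumberField K]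

attribute [local instance] adelicBorel borelSpace_adelic locallyCompactSpace_adelic
  secondCountableTopology_gl_adelic

/-- Conjugation by `p ∈ P_k(𝔸_K)` is continuous on `𝔫_k(𝔸_K)`. [folklore] -/
theorem continuous_blockNilpotentConj (p : standardParabolicGL (AdeleRing (𝓞 K) K) (maximalParabolicLabel n k)) :
    Continuous (blockNilpotentConj p) := by
  refine Continuous.subtype_mk ?_ _
  exact (continuous_const.mul continuous_subtype_val).mul continuous_const

/-- The inverse of `blockNilpotentConj p` is `blockNilpotentConj p⁻¹`. [folklore] -/
theorem blockNilpotentConj_symm_apply (p : standardParabolicGL (AdeleRing (𝓞 K) K) (maximalParabolicLabel n k))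
    (X : blockNilpotent n k (AdeleRing (𝓞 K) K)) :
    (blockNilpotentConj p).symm X = blockNilpotentConj p⁻¹ X := by
  refine Subtype.ext ?_
  rw [coe_blockNilpotentConj, Subgroup.coe_inv, inv_inv]
  rfl

/-- **Conjugation by a rational element of `P_k` preserves every additive Haar measure of
`𝔫_k(𝔸_K)`** (the module of `X ↦ γ X γ⁻¹` is `|det|`-type and equals `1` by the product formula;
here: the image measure is again a Haar measure, hence `c · ν`, and the conjugate of a fundamental
domain of the lattice `𝔫_k(K)` — preserved by rational `γ` — is a fundamental domain of the same
measure, so `c = 1`). Weil, *Basic Number Theory*, Ch. I §2; Moeglin–Waldspurger (1995), I.2.6.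
[cite: MoeglinWaldspurger1995, I.2.6] -/
theorem map_blockNilpotentConj_eq_self (ν : Measure (blockNilpotent n k (AdeleRing (𝓞 K) K))) [ν.IsAddHaarMeasure]
    {p : standardParabolicGL (AdeleRing (𝓞 K) K) (maximalParabolicLabel n k)} {γ : GL (Fin n) K}
    (hp : (p : GL (Fin n) (AdeleRing (𝓞 K) K)) = Matrix.GeneralLinearGroup.map (algebraMap K (AdeleRing (𝓞 K) K)) γ) :
    ν.map (blockNilpotentConj p) = ν := by
  haveI := locallyCompactSpace_blockNilpotent n k K
  haveI := t2Space_blockNilpotent n k K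
  haveI : SecondCountableTopology (blockNilpotent n k (AdeleRing (𝓞 K) K)) := secondCountableTopology_blockNilpotent n k K
  haveI : Countable (rationalBlock n k K) := rationalBlock_countable
  have hTc : Continuous (blockNilpotentConj p) := continuous_blockNilpotentConj p
  have hTsc : Continuous (blockNilpotentConj p).symm :=
    (continuous_blockNilpotentConj p⁻¹).congr fun X => (blockNilpotentConj_symm_apply p X).symm
  haveI hH : (ν.map (blockNilpotentConj p)).IsAddHaarMeasure :=
    AddEquiv.isAddHaarMeasure_map ν (blockNilpotentConj p) hTc hTsc
  -- both are multiples of a fixed Haar measure: `ν.map T = c • ν`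
  obtain ⟨K₀, -⟩ := exists_positiveCompacts_subset isOpen_univ
    (⟨0, mem_univ _⟩ : (univ : Set (blockNilpotent n k (AdeleRing (𝓞 K) K))).Nonempty)
  have hK0 : ν K₀ ≠ 0 := fun h0 =>
    (isOpen_interior.measure_pos ν K₀.interior_nonempty).ne' (measure_mono_null interior_subset h0)
  have hKtop : ν K₀ ≠ ⊤ := K₀.isCompact.measure_lt_top.ne
  have h1 := addHaarMeasure_unique ν K₀
  have h2 := addHaarMeasure_unique (ν.map (blockNilpotentConj p)) K₀
  have hμ₀ : (ν K₀)⁻¹ • ν = addHaarMeasure K₀ := by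
    nth_rewrite 2 [h1]
    rw [smul_smul, ENNReal.inv_mul_cancel hK0 hKtop, one_smul]
  have hcν : ν.map (blockNilpotentConj p) = ((ν.map (blockNilpotentConj p)) K₀ * (ν K₀)⁻¹) • ν := by
    rw [← smul_smul, hμ₀]
    exact h2
  set c : ℝ≥0∞ := (ν.map (blockNilpotentConj p)) K₀ * (ν K₀)⁻¹ with hc
  -- the fundamental domain argument: `c = 1`
  set 𝓕 : Set (blockNilpotent n k (AdeleRing (𝓞 K) K)) := scaledBlockFundamentalDomain n k K (1 : K) with h𝓕def
  have h𝓕 : IsAddFundamentalDomain (rationalBlock n k K) 𝓕 ν :=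
    isAddFundamentalDomain_scaledBlockFundamentalDomain one_ne_zero ν
  have h𝓕m : MeasurableSet 𝓕 := by
    have h := measurableSet_vadd_scaledBlockFundamentalDomain (n := n) (k := k) (K := K) (one_ne_zero (α := K)) 0
    rwa [zero_vadd] at h
  have h𝓕0 : ν 𝓕 ≠ 0 := measure_scaledBlockFundamentalDomain_ne_zero one_ne_zero ν
  have h𝓕top : ν 𝓕 ≠ ⊤ := (measure_scaledBlockFundamentalDomain_lt_top (1 : K) ν).ne
  have hqmp : Measure.QuasiMeasurePreserving (blockNilpotentConj p) ν ν := by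
    refine ⟨hTc.measurable, ?_⟩
    rw [hcν]
    exact Measure.smul_absolutelyContinuous
  -- the lattice bijection `e = T⁻¹|_{𝔫_k(K)}`
  have hp' : ((p⁻¹ : standardParabolicGL (AdeleRing (𝓞 K) K) (maximalParabolicLabel n k)) : GL (Fin n) (AdeleRing (𝓞 K) K)) =
      Matrix.GeneralLinearGroup.map (algebraMap K (AdeleRing (𝓞 K) K)) γ⁻¹ := by
    rw [Subgroup.coe_inv, hp, map_inv]
  have hmemT : ∀ g : rationalBlock n k K, (blockNilpotentConj p) (g : blockNilpotent n k (AdeleRing (𝓞 K) K)) ∈ rationalBlock n k K :=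
    fun g => blockNilpotentConj_mem_rationalBlock hp g.2
  have hmemTs : ∀ g : rationalBlock n k K, (blockNilpotentConj p).symm (g : blockNilpotent n k (AdeleRing (𝓞 K) K)) ∈ rationalBlock n k K := by
    intro g
    rw [blockNilpotentConj_symm_apply]
    exact blockNilpotentConj_mem_rationalBlock hp' g.2
  set e : rationalBlock n k K → rationalBlock n k K := fun g => ⟨(blockNilpotentConj p).symm g, hmemTs g⟩ with he
  have hebij : Function.Bijective e := by
    refine ⟨fun a b hab => ?_, fun g => ⟨⟨blockNilpotentConj p g, hmemT g⟩, ?_⟩⟩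
    · have h := congrArg (fun x : rationalBlock n k K => blockNilpotentConj p (x : blockNilpotent n k (AdeleRing (𝓞 K) K))) hab
      simp only [he, AddEquiv.apply_symm_apply] at h
      exact Subtype.ext h
    · exact Subtype.ext ((blockNilpotentConj p).symm_apply_apply _)
  have hsemi : ∀ g : rationalBlock n k K, Function.Semiconj (blockNilpotentConj p) ((e g) +ᵥ ·) (g +ᵥ ·) := by
    intro g X
    change blockNilpotentConj p (((blockNilpotentConj p).symm g : blockNilpotent n k (AdeleRing (𝓞 K) K)) + X) = (g : blockNilpotent n k (AdeleRing (𝓞 K) K)) + blockNilpotentConj p X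
    rw [map_add, AddEquiv.apply_symm_apply]
  have h𝓕' : IsAddFundamentalDomain (rationalBlock n k K) ((blockNilpotentConj p) ⁻¹' 𝓕) ν := h𝓕.preimage_of_equiv hqmp hebij hsemi
  have hmeas : ν ((blockNilpotentConj p) ⁻¹' 𝓕) = ν 𝓕 := h𝓕'.measure_eq h𝓕
  have hc1 : c = 1 := by
    have h : (ν.map (blockNilpotentConj p)) 𝓕 = c * ν 𝓕 := by rw [hcν]; rfl
    rw [Measure.map_apply hTc.measurable h𝓕m, hmeas] at h
    have h' : 1 * ν 𝓕 = c * ν 𝓕 := by rw [one_mul]; exact h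
    exact ((ENNReal.mul_left_inj h𝓕0 h𝓕top).1 h').symm
  rw [hcν, hc1, one_smul]

/-- **Conjugation invariance in the transported form**: for a rational `p ∈ P_k` and `g ≥ 0` on
`GL_n(𝔸_K)`, `∫ g(p u p⁻¹) du = ∫ g(u) du` over `N_k(𝔸_K)`. [folklore] -/
theorem lintegral_blockUnipotentMeasure_conj (ν : Measure (blockNilpotent n k (AdeleRing (𝓞 K) K))) [ν.IsAddHaarMeasure]
    {p : standardParabolicGL (AdeleRing (𝓞 K) K) (maximalParabolicLabel n k)} {γ : GL (Fin n) K}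
    (hp : (p : GL (Fin n) (AdeleRing (𝓞 K) K)) = Matrix.GeneralLinearGroup.map (algebraMap K (AdeleRing (𝓞 K) K)) γ)
    (g : (AdelicGroupData.gl n K).Adelic → ℝ≥0∞) :
    ∫⁻ u, g (parabolicToAdelic p * (u : (AdelicGroupData.gl n K).Adelic) * (parabolicToAdelic p)⁻¹)
        ∂(blockUnipotentMeasure n k K ν) =
      ∫⁻ u, g (u : (AdelicGroupData.gl n K).Adelic) ∂(blockUnipotentMeasure n k K ν) := by
  rw [lintegral_blockUnipotentMeasure, lintegral_blockUnipotentMeasure]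
  have h : ∀ X : blockNilpotent n k (AdeleRing (𝓞 K) K),
      parabolicToAdelic p * (toBlockUnipotentGL n k K X : (AdelicGroupData.gl n K).Adelic) * (parabolicToAdelic p)⁻¹ =
      (toBlockUnipotentGL n k K (blockNilpotentConj p X) : (AdelicGroupData.gl n K).Adelic) :=
    fun X => (toBlockUnipotentGL_blockNilpotentConj p X).symm
  simp_rw [h]
  have hsymm : ((blockNilpotentConj p).toEquiv.symm :
      blockNilpotent n k (AdeleRing (𝓞 K) K) → blockNilpotent n k (AdeleRing (𝓞 K) K)) =
      fun X => blockNilpotentConj p⁻¹ X := funext (blockNilpotentConj_symm_apply p)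
  set e : blockNilpotent n k (AdeleRing (𝓞 K) K) ≃ᵐ blockNilpotent n k (AdeleRing (𝓞 K) K) :=
    ⟨(blockNilpotentConj p).toEquiv, (continuous_blockNilpotentConj p).measurable, by
      rw [hsymm]; exact (continuous_blockNilpotentConj p⁻¹).measurable⟩ with he
  have hmap := lintegral_map_equiv (μ := ν)
    (fun X : blockNilpotent n k (AdeleRing (𝓞 K) K) => g (toBlockUnipotentGL n k K X : (AdelicGroupData.gl n K).Adelic)) e
  have hcoe : (e : blockNilpotent n k (AdeleRing (𝓞 K) K) → blockNilpotent n k (AdeleRing (𝓞 K) K)) =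
      fun X => blockNilpotentConj p X := rfl
  rw [hcoe] at hmap
  change ∫⁻ X, g (toBlockUnipotentGL n k K (blockNilpotentConj p X) : (AdelicGroupData.gl n K).Adelic) ∂ν =
    ∫⁻ X, g (toBlockUnipotentGL n k K X : (AdelicGroupData.gl n K).Adelic) ∂ν
  rw [← hmap, map_blockNilpotentConj_eq_self ν hp]

end Conj

/-! ### The fundamental domain in `N_k(𝔸_K)`, commutation in the mean, and cusp periods -/

section Domain

variable {n k : ℕ} {K : Type} [Field K] [NumberField K]

attribute [local instance] adelicBorel borelSpace_adelic locallyCompactSpace_adelic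
  secondCountableTopology_gl_adelic

variable (n k K) in
/-- **A strict measurable fundamental domain of `N_k(K)` in `N_k(𝔸_K)`**: the image of Tate's scaled
block domain `1 · 𝓕₀ ⊆ 𝔫_k(𝔸_K)` (`scaledBlockFundamentalDomain`) under `X ↦ 1 + X`. [folklore] -/
def blockUnipotentDomain : Set (blockUnipotentGL n k K) :=
  toBlockUnipotentGL n k K '' scaledBlockFundamentalDomain n k K (1 : K)

/-- Tate's scaled block domain is a Borel set. [folklore] -/
theorem measurableSet_scaledBlockFundamentalDomain_one :
    MeasurableSet (scaledBlockFundamentalDomain n k K (1 : K)) := by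
  have h := measurableSet_vadd_scaledBlockFundamentalDomain (n := n) (k := k) (K := K) (one_ne_zero (α := K)) 0
  rwa [zero_vadd] at h

/-- The domain is a Borel set. [folklore] -/
theorem measurableSet_blockUnipotentDomain : MeasurableSet (blockUnipotentDomain n k K) :=
  (blockUnipotentGLMeasurableEquiv n k K).measurableEmbedding.measurableSet_image.2
    measurableSet_scaledBlockFundamentalDomain_one

/-- The measure of the domain is the measure of Tate's scaled block domain. [folklore] -/
theorem blockUnipotentMeasure_blockUnipotentDomain (ν : Measure (blockNilpotent n k (AdeleRing (𝓞 K) K))) :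
    blockUnipotentMeasure n k K ν (blockUnipotentDomain n k K) = ν (scaledBlockFundamentalDomain n k K (1 : K)) :=
  blockUnipotentMeasure_image ν _

/-- The domain has positive measure. [folklore] -/
theorem blockUnipotentMeasure_blockUnipotentDomain_ne_zero (ν : Measure (blockNilpotent n k (AdeleRing (𝓞 K) K)))
    [ν.IsAddHaarMeasure] : blockUnipotentMeasure n k K ν (blockUnipotentDomain n k K) ≠ 0 := by
  rw [blockUnipotentMeasure_blockUnipotentDomain]
  exact measure_scaledBlockFundamentalDomain_ne_zero one_ne_zero ν

/-- The domain has finite measure. [folklore] -/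
theorem blockUnipotentMeasure_blockUnipotentDomain_ne_top (ν : Measure (blockNilpotent n k (AdeleRing (𝓞 K) K)))
    [IsFiniteMeasureOnCompacts ν] : blockUnipotentMeasure n k K ν (blockUnipotentDomain n k K) ≠ ⊤ := by
  rw [blockUnipotentMeasure_blockUnipotentDomain]
  exact (measure_scaledBlockFundamentalDomain_lt_top (1 : K) ν).ne

/-- **Strict unique representability**: if `Γ' ∩ N_k(𝔸_K) = N_k(K)` then every `u ∈ N_k(𝔸_K)` has
exactly one `η ∈ Γ' ∩ N_k(𝔸_K)` with `η u` in the domain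
(`existsUnique_vadd_mem_vadd_scaledBlockFundamentalDomain` transported along `X ↦ 1 + X`). [folklore] -/
theorem existsUnique_mul_mem_blockUnipotentDomain {Γ' : Subgroup (AdelicGroupData.gl n K).Adelic}
    (hΓ' : ∀ u : blockUnipotentGL n k K, (u : (AdelicGroupData.gl n K).Adelic) ∈ Γ' ↔
      logBlockUnipotentGL u ∈ rationalBlock n k K)
    (u : blockUnipotentGL n k K) :
    ∃! η : Γ'.subgroupOf (blockUnipotentGL n k K), ((η : blockUnipotentGL n k K) * u) ∈ blockUnipotentDomain n k K := by
  obtain ⟨X, rfl⟩ := toBlockUnipotentGL_bijective.2 u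
  obtain ⟨γ, hγ, huniq⟩ := existsUnique_vadd_mem_vadd_scaledBlockFundamentalDomain (n := n) (k := k) (K := K)
    (one_ne_zero (α := K)) 0 X
  rw [zero_vadd] at hγ
  have hmemΓ : ∀ δ : rationalBlock n k K, (toBlockUnipotentGL n k K (δ : blockNilpotent n k (AdeleRing (𝓞 K) K)) :
      (AdelicGroupData.gl n K).Adelic) ∈ Γ' := fun δ => by
    rw [hΓ', logBlockUnipotentGL_toBlockUnipotentGL]; exact δ.2
  refine ⟨⟨toBlockUnipotentGL n k K (γ : blockNilpotent n k (AdeleRing (𝓞 K) K)), Subgroup.mem_subgroupOf.2 (hmemΓ γ)⟩,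
    ?_, fun η hη => ?_⟩
  · show toBlockUnipotentGL n k K (γ : blockNilpotent n k (AdeleRing (𝓞 K) K)) * toBlockUnipotentGL n k K X ∈ _
    rw [← toBlockUnipotentGL_add]
    exact ⟨_, hγ, rfl⟩
  · -- `η = 1 + δ` with `δ` rational
    have hηΓ : ((η : blockUnipotentGL n k K) : (AdelicGroupData.gl n K).Adelic) ∈ Γ' := Subgroup.mem_subgroupOf.1 η.2
    rw [hΓ'] at hηΓ
    set δ : rationalBlock n k K := ⟨logBlockUnipotentGL (η : blockUnipotentGL n k K), hηΓ⟩ with hδ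
    have hηδ : (η : blockUnipotentGL n k K) = toBlockUnipotentGL n k K (δ : blockNilpotent n k (AdeleRing (𝓞 K) K)) := by
      rw [hδ]; exact (toBlockUnipotentGL_logBlockUnipotentGL _).symm
    have hmem : (δ : blockNilpotent n k (AdeleRing (𝓞 K) K)) + X ∈ scaledBlockFundamentalDomain n k K (1 : K) := by
      have h : toBlockUnipotentGL n k K ((δ : blockNilpotent n k (AdeleRing (𝓞 K) K)) + X) ∈ blockUnipotentDomain n k K := by
        rw [toBlockUnipotentGL_add, ← hηδ]; exact hη
      obtain ⟨Y, hY, hYeq⟩ := h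
      rwa [← toBlockUnipotentGL_bijective.1 hYeq]
    have hδγ : δ = γ := huniq δ (by rw [zero_vadd]; exact hmem)
    refine Subtype.ext ?_
    rw [hηδ, hδγ]

/-- **`Γ'` and `N_k(𝔸_K)` commute in the mean** (hypothesis `hcomm` of `CoveringWeightsAveraging`):
for a rational `p ∈ P_k`, `g ≥ 0` on `GL_n(𝔸_K)` and `x ∈ GL_n(𝔸_K)`,
`∫ g(p u x) du = ∫ g(u p x) du`. [folklore] -/
theorem lintegral_blockUnipotentMeasure_mul_comm (ν : Measure (blockNilpotent n k (AdeleRing (𝓞 K) K))) [ν.IsAddHaarMeasure]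
    {p : standardParabolicGL (AdeleRing (𝓞 K) K) (maximalParabolicLabel n k)} {γ : GL (Fin n) K}
    (hp : (p : GL (Fin n) (AdeleRing (𝓞 K) K)) = Matrix.GeneralLinearGroup.map (algebraMap K (AdeleRing (𝓞 K) K)) γ)
    (g : (AdelicGroupData.gl n K).Adelic → ℝ≥0∞) (x : (AdelicGroupData.gl n K).Adelic) :
    ∫⁻ u, g (parabolicToAdelic p * (u : (AdelicGroupData.gl n K).Adelic) * x) ∂(blockUnipotentMeasure n k K ν) =
      ∫⁻ u, g ((u : (AdelicGroupData.gl n K).Adelic) * parabolicToAdelic p * x) ∂(blockUnipotentMeasure n k K ν) := by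
  have h := lintegral_blockUnipotentMeasure_conj ν hp (fun y => g (y * parabolicToAdelic p * x))
  simp only [inv_mul_cancel_right] at h
  exact h

/-- **Cusp periods vanish on the domain**: for `φ` satisfying the (left) cusp condition along `P_k`
(`CuspConditionGL`, e.g. `invQuot` of a smoothed cusp form) and an additive Haar measure `ν` on
`𝔫_k(𝔸_K)`, `∫_{𝓕_U} φ(u⁻¹ x) du = 0` for every `x` — the vanishing of the constant term
`∫_{N_k(K)\N_k(𝔸_K)} φ(u x) du`, read through `u ↦ u⁻¹` (`AutomorphicRepsGL.negTransfer_blockNilpotent`).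
Borel–Jacquet (1979), 4.4. [cite: BorelJacquet1979, 4.4] -/
theorem setIntegral_blockUnipotentDomain_inv_mul_eq_zero {φ : (AdelicGroupData.gl n K).Adelic → ℂ}
    (hφ : CuspConditionGL n K φ k) (ν : Measure (blockNilpotent n k (AdeleRing (𝓞 K) K))) [ν.IsAddHaarMeasure]
    (x : (AdelicGroupData.gl n K).Adelic) :
    ∫ u in blockUnipotentDomain n k K, φ ((u : (AdelicGroupData.gl n K).Adelic)⁻¹ * x) ∂(blockUnipotentMeasure n k K ν) = 0 := by
  rw [blockUnipotentDomain, setIntegral_blockUnipotentMeasure_image]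
  have hinv : ∀ X : blockNilpotent n k (AdeleRing (𝓞 K) K),
      ((toBlockUnipotentGL n k K X : blockUnipotentGL n k K) : (AdelicGroupData.gl n K).Adelic)⁻¹ =
        glUnipotent n k K (Multiplicative.ofAdd (-X)) := fun X => by
    rw [coe_toBlockUnipotentGL, ofAdd_neg, map_inv]
  simp_rw [hinv]
  have h𝓕 : IsAddFundamentalDomain (rationalBlock n k K) (scaledBlockFundamentalDomain n k K (1 : K)) ν :=
    isAddFundamentalDomain_scaledBlockFundamentalDomain one_ne_zero ν
  obtain ⟨hν', h𝓕', htr⟩ := AutomorphicRepsGL.negTransfer_blockNilpotent ν h𝓕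
  obtain ⟨-, h0⟩ := @hφ (ν.map Neg.neg) hν' (Neg.neg ⁻¹' scaledBlockFundamentalDomain n k K (1 : K)) h𝓕' x
  rw [(htr (fun X => φ (glUnipotent n k K (Multiplicative.ofAdd X) * x))).2] at h0
  exact h0

end Domain

end Literature.NumberTheory.Automorphic
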